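import Summits.BirchSwinnertonDyer.Rank1Residual.X11b.AnticyclotomicControlBadImprimitive
import Summits.BirchSwinnertonDyer.Rank1Residual.X11b.AnticyclotomicInertPlaces
import Summits.BirchSwinnertonDyer.Rank1Residual.X11b.AnticyclotomicRamifiedPlaces
import Literature.NumberTheory.EllipticCurves.HeegnerPointsKolyvaginGoodReductionProofs
import Literature.NumberTheory.EllipticCurves.ModularityVersionApProofs
import HarnessLib

/-!
# X11b, route R1 — ANTICYCLOTOMIC control in Castella's shape: the `N⁺`-imprimitive control map
# `Sel_𝔭^Σ(K, E[p^∞]) → Sel_𝔭^Σ(K_∞^{ac}, E[p^∞])^Γ` is an ISOMORPHISM for `Σ ⊇ {bad v ∤ p over SPLIT primes}`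

HONEST FRAMING (cell `b2b-bsdres`, run/shared/lean/b2b/bsd-rank1-residual/, verbatim in every
file): the goal of the cell is to DELETE the COMBINATION-SHAPED residual classes of the
Birch–Swinnerton-Dyer formula for ALL analytic-rank `≤ 1` elliptic curves over `ℚ` — "full BSD
formula for every rank `≤ 1` curve in class `C`" assembled STRICTLY from published theorems — so
that the rank-`≤ 1` remainder becomes exactly the CONSTRUCTION-SHAPED classes, which are TYPED
(missing-input `Prop`s), NOT attempted. This is not "finishing BSD". Sub-cell
`b2b-bsdres-multr1-p1` (X11b, route R1 = Castella 2018 Thm. A re-proved along the author's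
erratum); a RESEARCH ROUTE; no claim beyond the stated class; X11b stays CONSTRUCTION-SHAPED;
nothing here changes a label; no named fact is minted (proved theorems only; no `sorry`).

## Why this file

Cas18 Thm. 2.3 (⇐ JSW17 Thm. 3.3.1), the PUB-shaped control input `R1ControlOnTreeAt` of route R1,
carries the Tamagawa term `∏_{w ∣ N⁺} c_w^{(p)}(E/K)` over the places of `K` above the primes of `N`
that SPLIT in `K` — and nothing at the other bad places. On the constructed objects this is now
explained by kernel theorems: in the ANTICYCLOTOMIC `ℤ_p`-extension of an imaginary quadratic `K`,
Greenberg's local kernel `ker(H¹(K_v, E[p^∞]) → H¹(K_{∞,w}, E[p^∞]))` at a finite `v ∤ p` VANISHES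
* at every place of GOOD reduction (`AnticyclotomicGoodPlaces`, Lemma 3.3, any `ℤ_p`-extension),
* at every place over a prime INERT in `K` (`AnticyclotomicInertPlaces`: such `v` split completely),
* at every place over a prime RAMIFIED in `K` (`AnticyclotomicRamifiedPlaces`: likewise),
so the ONLY places where the away condition can fail to descend are the bad places over primes
SPLIT in `K` (`e = f = 1`), i.e. the `w ∣ N⁺`. This file assembles:

* `away_descent_of_splitBad_subset` — for `[K : ℚ] = 2`, `κ` anticyclotomic and
  `Σ ⊇ {v ∤ p : E_K bad at v, e(v|ℓ) = f(v|ℓ) = 1}`, the hypothesis `hS` of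
  `controlMap_bijective_of_away_descent` HOLDS (quadratic trichotomy `e·f·g = 2`);
* **`IsAnticyclotomic.controlMap_bijective_of_splitBad_subset`** — for `K` imaginary quadratic
  (`[K:ℚ] = 2`, totally complex), ANY elliptic `E/K`, `κ` anticyclotomic with topological generator
  `γ`, `𝔭` with `E(K̄)[p^∞]^{D_𝔭 ⊓ ker κ} = 0`, `H¹(K, E[p^∞]) ↪ H¹(K_∞, E[p^∞])`, and ANY such `Σ`:
  `s : Sel_𝔭^Σ(K, E[p^∞]) → Sel_𝔭^Σ(K_∞, E[p^∞])^γ` is BIJECTIVE; counting form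
  `XAc.hasCharValuationAt_iff_card_base_of_splitBad_subset` (finite `Σ`): "`ord_p f_ac^Σ(0) = n`" ⟺
  `#Sel_𝔭^Σ(K, E[p^∞]) = p^n · #Sel_𝔭^Σ(K_∞, E[p^∞])_γ`, NO residual input;
* route R1: **`ChainLocus.controlMap_bijective_of_conductor_split_subset`** — on `ChainLocus`, for every
  imaginary quadratic `K`, degree-one `𝔭 ∣ p`, anticyclotomic `κ`, and every
  `Σ ⊇ {v ∤ p : ℓ_v ∣ N_E, e(v|ℓ_v) = f(v|ℓ_v) = 1}` (the places above `N⁺`, via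
  `dvd_conductorNorm_iff` and good reduction under base change): `s` is bijective — Irr ∧ Ram and the
  erratum's (iv) discharge the other two hypotheses (gens 9–10).

What remains of Cas18 Thm. 2.3 / JSW §3.3 beyond this: the passage from `Σ = {w ∣ N⁺}` to `Σ = ∅`
(the local kernels of order `c_w^{(p)}` at the `w ∣ N⁺`, finitely decomposed in `K_∞` — the Tamagawa
factors; Greenberg Lemma 3.3 bad case / [GreenbergLNM1716] §4), the order of `Sel_𝔭(K, E[p^∞])`
(JSW §3.3.5, Poitou–Tate) and `Sel_Γ = 0` (§3.3.6). No label changes.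

References: [Castella2018] Def. 2.2, Thm. 2.3 (arXiv:1704.06608 p. 5); [JetchevSkinnerWan2017] §3.3,
Thm. 3.3.1 (arXiv:1512.06894; shape only); [GreenbergLNM1716] §3 Lemmas 3.1–3.3, p. 87, p. 90.
-/

noncomputable section

open scoped Classical

open NumberField IsDedekindDomain Field
open Literature.NumberTheory.EllipticCurves Literature.NumberTheory.EllipticCurves.GreenbergSelmer
open Literature.NumberTheory.GaloisRepresentations IsDedekindDomain.HeightOneSpectrum

namespace Summit.BirchSwinnertonDyer.Rank1Residual.X11b.AcSelmer

section Quadratic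

variable {K : Type} [Field K] [NumberField K] (E : WeierstrassCurve K) [E.IsElliptic]
  (p : ℕ) [Fact p.Prime] (κ : ZpExtension K p) (𝔭 : HeightOneSpectrum (𝓞 K))
  (S : Set (HeightOneSpectrum (𝓞 K)))

/-- In a quadratic field every finite place has `(e, f) = (1, 1)`, `(1, 2)` or `(2, 1)` over `ℚ`
(`e·f·g = 2`, tree `placesOver_trichotomy_of_finrank_eq_two`). [cite: NeukirchANT1999, Ch. I (8.2)] -/
theorem inertiaDeg_eq_two_or_ramificationIdx_eq_two (hK : Module.finrank ℚ K = 2)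
    (v : HeightOneSpectrum (𝓞 K))
    (h : ¬ (v.asIdeal.ramificationIdx (𝓞 ℚ) = 1 ∧ v.asIdeal.inertiaDeg (𝓞 ℚ) = 1)) :
    v.asIdeal.inertiaDeg (𝓞 ℚ) = 2 ∨ v.asIdeal.ramificationIdx (𝓞 ℚ) = 2 := by
  rcases placesOver_trichotomy_of_finrank_eq_two K hK (v.under (𝓞 ℚ)) with
    ⟨w₁, w₂, -, -, hef⟩ | ⟨w, hset, -, hf2⟩ | ⟨w, hset, he2, -⟩
  · exact absurd (hef v rfl) h
  · have hvw : v = w := by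
      have : v ∈ ({w' : HeightOneSpectrum (𝓞 K) | w'.under (𝓞 ℚ) = v.under (𝓞 ℚ)}) := rfl
      rw [hset] at this; exact this
    subst hvw; exact Or.inl hf2
  · have hvw : v = w := by
      have : v ∈ ({w' : HeightOneSpectrum (𝓞 K) | w'.under (𝓞 ℚ) = v.under (𝓞 ℚ)}) := rfl
      rw [hset] at this; exact this
    subst hvw; exact Or.inr he2

/-- **The away-descent hypothesis HOLDS for `Σ ⊇ {bad v ∤ p over split primes}`** (`[K : ℚ] = 2`,
`κ` anticyclotomic): if `res_{K→K_∞} c ∈ Sel_𝔭^Σ(K_∞, E[p^∞])` then `c` is locally trivial at every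
finite `v ∉ Σ`, `v ∤ p` — such a `v` is good (`AnticyclotomicGoodPlaces`), or lies over an inert
prime (`AnticyclotomicInertPlaces`), or over a ramified prime (`AnticyclotomicRamifiedPlaces`).
[cite: GreenbergLNM1716, §3 Lemma 3.3 and p. 87] [cite: Castella2018, Thm. 2.3 (arXiv:1704.06608 p. 5): `∏_{w∣N⁺}`] -/
theorem away_descent_of_splitBad_subset (hK : Module.finrank ℚ K = 2) (hκ : κ.IsAnticyclotomic)
    (hS : ∀ v : HeightOneSpectrum (𝓞 K), (p : 𝓞 K) ∉ v.asIdeal → ¬ E.HasGoodReductionAt v →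
      v.asIdeal.ramificationIdx (𝓞 ℚ) = 1 → v.asIdeal.inertiaDeg (𝓞 ℚ) = 1 → v ∈ S)
    (c : E.subgroupH1 p (⊤ : Subgroup (absoluteGaloisGroup K)))
    (hc : resOfLe (E.geomPrimaryTorsion p) (le_top : κ.kerSubgroup ≤ ⊤) c ∈ selmerAc E p κ 𝔭 S)
    (v : HeightOneSpectrum (𝓞 K)) (hpv : ((p : ℕ) : 𝓞 K) ∉ v.asIdeal) (hvS : v ∉ S) :
    c ∈ awayKer ⊤ (E.geomPrimaryTorsion p) v := by
  have h1 := ((mem_selmerOver_iff _).mp hc).1 v hpv hvS 1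
  rw [conjH1_one_holds, AddMonoidHom.id_apply] at h1
  by_cases hgood : E.HasGoodReductionAt v
  · exact (resOfLe_mem_awayKer_kerSubgroup_iff_of_hasGoodReductionAt E p κ hpv hgood c).mp h1
  · have hnot : ¬ (v.asIdeal.ramificationIdx (𝓞 ℚ) = 1 ∧ v.asIdeal.inertiaDeg (𝓞 ℚ) = 1) :=
      fun h ↦ hvS (hS v hpv hgood h.1 h.2)
    rcases inertiaDeg_eq_two_or_ramificationIdx_eq_two hK v hnot with hf | he
    · exact (IsAnticyclotomic.resOfLe_mem_awayKer_iff_of_inertiaDeg_eq_two hK hκ hpv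
        (ℓ := v.under (𝓞 ℚ)) rfl hf c).mp h1
    · exact (IsAnticyclotomic.resOfLe_mem_awayKer_iff_of_ramificationIdx_eq_two hK hκ hpv he c).mp h1

/-- **Anticyclotomic control, `N⁺`-imprimitive shape: `s` is BIJECTIVE.** For `K` imaginary quadratic
(`[K : ℚ] = 2`, totally complex), an elliptic curve `E/K`, `κ` the (an) ANTICYCLOTOMIC `ℤ_p`-extension
with topological generator `γ`, a prime `𝔭` with `E(K̄)[p^∞]^{D_𝔭 ⊓ ker κ} = 0` (strict place),
`H¹(K, E[p^∞]) ↪ H¹(K_∞, E[p^∞])`, and ANY `Σ ⊇ {v ∤ p : E bad at v, v over a prime split in K}`: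
`s : Sel_𝔭^Σ(K, E[p^∞]) → Sel_𝔭^Σ(K_∞, E[p^∞])^γ` is bijective. (Every other finite `v ∤ p` has local
kernel `0`: good places by Lemma 3.3, inert and ramified places because they split completely in
`K_∞^{ac}`.) [cite: JetchevSkinnerWan2017, §3.3 and Thm. 3.3.1 (shape only)] [cite: Castella2018, Thm. 2.3 (arXiv:1704.06608 p. 5)] [cite: GreenbergLNM1716, §3 pp. 85–90] -/
theorem IsAnticyclotomic.controlMap_bijective_of_splitBad_subset [IsTotallyComplex K]
    (hK : Module.finrank ℚ K = 2) (hκ : κ.IsAnticyclotomic) {γ : absoluteGaloisGroup K}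
    (hγ : κ.IsTopGenerator γ)
    (hinj : Function.Injective (ResKernel.resSubgroup κ.kerSubgroup (E.geomPrimaryTorsion p)))
    (h0 : FixedPoints.addSubgroup ↥(decomp 𝔭 ⊓ κ.kerSubgroup) (E.geomPrimaryTorsion p) = ⊥)
    (hS : ∀ v : HeightOneSpectrum (𝓞 K), (p : 𝓞 K) ∉ v.asIdeal → ¬ E.HasGoodReductionAt v →
      v.asIdeal.ramificationIdx (𝓞 ℚ) = 1 → v.asIdeal.inertiaDeg (𝓞 ℚ) = 1 → v ∈ S) :
    Function.Bijective (controlMap E p κ 𝔭 S γ) :=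
  controlMap_bijective_of_away_descent E p κ 𝔭 S hγ hinj h0
    (fun c hc v hpv hvS ↦ away_descent_of_splitBad_subset E p κ 𝔭 S hK hκ hS c hc v hpv hvS)

/-- **Counting form, NO residual input** (finite `Σ ⊇ {bad v ∤ p over split primes}`, anticyclotomic
`κ`, `K` imaginary quadratic): "`ord_p f_ac^Σ(0) = n`" for the constructed `X_ac^Σ(E[p^∞])` ⟺
`Sel_𝔭^Σ(K, E[p^∞])` finite with `#Sel_𝔭^Σ(K, E[p^∞]) = p^n · #Sel_𝔭^Σ(K_∞, E[p^∞])_γ`.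
[cite: GreenbergLNM1716, §4 Lemma 4.2 (p. 102)] [cite: JetchevSkinnerWan2017, §3.3 (shape only)] -/
theorem XAc.hasCharValuationAt_iff_card_base_of_splitBad_subset [IsTotallyComplex K]
    (hK : Module.finrank ℚ K = 2) (hκ : κ.IsAnticyclotomic)
    (γ : absoluteGaloisGroup K) [hγ : Fact (κ.IsTopGenerator γ)] (hSfin : S.Finite)
    (hinj : Function.Injective (ResKernel.resSubgroup κ.kerSubgroup (E.geomPrimaryTorsion p)))
    (h0 : FixedPoints.addSubgroup ↥(decomp 𝔭 ⊓ κ.kerSubgroup) (E.geomPrimaryTorsion p) = ⊥)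
    (hS : ∀ v : HeightOneSpectrum (𝓞 K), (p : 𝓞 K) ∉ v.asIdeal → ¬ E.HasGoodReductionAt v →
      v.asIdeal.ramificationIdx (𝓞 ℚ) = 1 → v.asIdeal.inertiaDeg (𝓞 ℚ) = 1 → v ∈ S) (n : ℕ) :
    XAc.HasCharValuationAt E p κ 𝔭 S γ n ↔
      ∃ _ : Finite (selmerAcBase E p 𝔭 S),
        Nat.card (selmerAcBase E p 𝔭 S) =
          p ^ n * Nat.card (IwasawaDual.EndCoinvariants (conjSelmerAc E p κ 𝔭 S γ - 1)) := by
  haveI := XAc.module_finite κ 𝔭 S γ hSfin (W := E)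
  exact XAc.hasCharValuationAt_iff_card_base E p κ 𝔭 S γ
    (IsAnticyclotomic.controlMap_bijective_of_splitBad_subset E p κ 𝔭 S hK hκ hγ.out hinj h0 hS) n

end Quadratic

end Summit.BirchSwinnertonDyer.Rank1Residual.X11b.AcSelmer

/-! ## Route R1: `ChainLocus`, the places above `N⁺` -/

namespace Summit.BirchSwinnertonDyer.Rank1Residual.X11b

section RouteR1

open AcSelmer Literature.NumberTheory.EllipticCurves.Rank1Residual

variable {W : WeierstrassCurve ℚ} [W.IsElliptic] [W.IsGloballyMinimal] {p : ℕ} [Fact p.Prime]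

omit [W.IsGloballyMinimal] in
/-- A place of `K` at which `E_K` has bad reduction lies over a prime dividing the conductor `N_E`
(good reduction is stable under base change, `hasGoodReductionAt_baseChange_of_hasGoodReductionAt_rat`;
`ℓ ∣ N_E ⟺` bad reduction at `ℓ`, `dvd_conductorNorm_iff`). [cite: SilvermanAEC2009, VII.5 Prop. 5.1(a)] [cite: DiamondShurman2005, §8.3 (p ∣ N_E iff bad reduction)] -/
theorem primesEquiv_under_dvd_conductorNorm_of_not_hasGoodReductionAt (K : Type) [Field K]
    [NumberField K] (v : HeightOneSpectrum (𝓞 K)) (hbad : ¬ (W.baseChange K).HasGoodReductionAt v) :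
    (Rat.HeightOneSpectrum.primesEquiv (v.under (𝓞 ℚ)) : ℕ) ∣ W.conductorNorm ℤ := by
  rw [W.dvd_conductorNorm_iff]
  intro hgood
  haveI : v.asIdeal.LiesOver (v.under (𝓞 ℚ)).asIdeal := ⟨rfl⟩
  exact hbad (hasGoodReductionAt_baseChange_of_hasGoodReductionAt_rat W (v.under (𝓞 ℚ)) v hgood)

/-- **Route R1: anticyclotomic control for the `N⁺`-imprimitive Selmer group, NO residual input.** On
route R1's population (`ChainLocus`), for EVERY imaginary quadratic `K`, EVERY degree-one `𝔭 ∣ p`, the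
anticyclotomic `ℤ_p`-extension `κ` (any `κ` with `IsAnticyclotomic`) with topological generator `γ`,
and every `Σ` containing the places `v ∤ p` above the primes `ℓ ∣ N_E` that SPLIT in `K`
(`e(v|ℓ) = f(v|ℓ) = 1` — Castella's `w ∣ N⁺`): `s : Sel_𝔭^Σ(K, E[p^∞]) → Sel_𝔭^Σ(K_∞, E[p^∞])^γ` is
BIJECTIVE. (Injective: Irr ∧ Ram; strict place: the erratum's (iv); good places: Lemma 3.3; inert and
ramified places split completely; Lemma 3.2; `K_w = ℂ`.)
[cite: Castella2018, Thm. 2.3 (arXiv:1704.06608 p. 5) (shape only)] [cite: JetchevSkinnerWan2017, Thm. 3.3.1 (shape only)] [cite: GreenbergLNM1716, §3 pp. 85–90] -/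
theorem ChainLocus.controlMap_bijective_of_conductor_split_subset (h : ChainLocus W p)
    (K : Type) [Field K] [NumberField K] (hK : IsImaginaryQuadratic K) {κ : ZpExtension K p}
    (hκ : κ.IsAnticyclotomic) {γ : absoluteGaloisGroup K} (hγ : κ.IsTopGenerator γ)
    (𝔭 : HeightOneSpectrum (𝓞 K)) (h𝔭 : ((p : ℕ) : 𝓞 K) ∈ 𝔭.asIdeal)
    (he : 𝔭.asIdeal.ramificationIdx (𝓞 ℚ) = 1) (hf : 𝔭.asIdeal.inertiaDeg (𝓞 ℚ) = 1)
    (S : Set (HeightOneSpectrum (𝓞 K)))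
    (hS : ∀ v : HeightOneSpectrum (𝓞 K), (p : 𝓞 K) ∉ v.asIdeal →
      (Rat.HeightOneSpectrum.primesEquiv (v.under (𝓞 ℚ)) : ℕ) ∣ W.conductorNorm ℤ →
      v.asIdeal.ramificationIdx (𝓞 ℚ) = 1 → v.asIdeal.inertiaDeg (𝓞 ℚ) = 1 → v ∈ S) :
    Function.Bijective (controlMap (W.baseChange K) p κ 𝔭 S γ) := by
  haveI : IsTotallyComplex K := hK.2
  exact IsAnticyclotomic.controlMap_bijective_of_splitBad_subset (W.baseChange K) p κ 𝔭 S hK.1 hκ hγ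
    (h.resSubgroup_kerSubgroup_injective K hK.1 κ)
    (h.fixedPoints_decomp_inf_kerSubgroup_eq_bot K κ 𝔭 h𝔭 he hf)
    (fun v hpv hbad he1 hf1 ↦ hS v hpv
      (primesEquiv_under_dvd_conductorNorm_of_not_hasGoodReductionAt K v hbad) he1 hf1)

/-- **On an erratum field** (`IsErratumField`: imaginary quadratic, `p ∣ N_E` split): anticyclotomic
control for the `N⁺`-imprimitive Selmer group, for every `𝔭 ∋ p` (degree one automatically), every
anticyclotomic `κ`, `γ`, every `Σ ⊇ {v ∤ p above the split ℓ ∣ N_E}`.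
[cite: Castella2018, §5 (arXiv:1704.06608 p. 12), choice of K, and Thm. 2.3 (p. 5) (shape only)] -/
theorem ChainLocus.controlMap_bijective_of_conductor_split_subset_of_isErratumField
    (h : ChainLocus W p) {q : ℕ} (K : Type) [Field K] [NumberField K] (hKf : IsErratumField W K q)
    (hpq : p ≠ q) (hpN : p ∣ W.conductorNorm ℤ) {κ : ZpExtension K p} (hκ : κ.IsAnticyclotomic)
    {γ : absoluteGaloisGroup K} (hγ : κ.IsTopGenerator γ) (𝔭 : HeightOneSpectrum (𝓞 K))
    (h𝔭 : ((p : ℕ) : 𝓞 K) ∈ 𝔭.asIdeal) (S : Set (HeightOneSpectrum (𝓞 K)))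
    (hS : ∀ v : HeightOneSpectrum (𝓞 K), (p : 𝓞 K) ∉ v.asIdeal →
      (Rat.HeightOneSpectrum.primesEquiv (v.under (𝓞 ℚ)) : ℕ) ∣ W.conductorNorm ℤ →
      v.asIdeal.ramificationIdx (𝓞 ℚ) = 1 → v.asIdeal.inertiaDeg (𝓞 ℚ) = 1 → v ∈ S) :
    Function.Bijective (controlMap (W.baseChange K) p κ 𝔭 S γ) :=
  have hsplit : SplitsIn K p := hKf.2.2.1 p (Fact.out : p.Prime) hpN hpq
  h.controlMap_bijective_of_conductor_split_subset K hKf.1 hκ hγ 𝔭 h𝔭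
    (degreeOne_of_splitsIn hKf.1.1 hsplit h𝔭).1 (degreeOne_of_splitsIn hKf.1.1 hsplit h𝔭).2 S hS

/-- **Route R1, counting form of the `N⁺`-imprimitive control step, NO residual input.** On
`ChainLocus`, for every imaginary quadratic `K`, every degree-one `𝔭 ∣ p`, every anticyclotomic `κ`
with topological generator `γ`, and every FINITE `Σ ⊇ {v ∤ p above the split ℓ ∣ N_E}`:
"`ord_p f_ac^Σ(0) = n`" ⟺ `Sel_𝔭^Σ(K, E[p^∞])` finite and
`#Sel_𝔭^Σ(K, E[p^∞]) = p^n · #H¹(Γ, Sel_𝔭^Σ(K_∞, E[p^∞]))`.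
[cite: Castella2018, Thm. 2.3 (arXiv:1704.06608 p. 5) (shape only)] [cite: JetchevSkinnerWan2017, §3.3.6 (shape only)] [cite: GreenbergLNM1716, §4 Lemma 4.2 (p. 102)] -/
theorem ChainLocus.hasCharValuationAt_iff_card_base_of_conductor_split_subset (h : ChainLocus W p)
    (K : Type) [Field K] [NumberField K] (hK : IsImaginaryQuadratic K) {κ : ZpExtension K p}
    (hκ : κ.IsAnticyclotomic) (γ : absoluteGaloisGroup K) [hγ : Fact (κ.IsTopGenerator γ)]
    (𝔭 : HeightOneSpectrum (𝓞 K)) (h𝔭 : ((p : ℕ) : 𝓞 K) ∈ 𝔭.asIdeal)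
    (he : 𝔭.asIdeal.ramificationIdx (𝓞 ℚ) = 1) (hf : 𝔭.asIdeal.inertiaDeg (𝓞 ℚ) = 1)
    {S : Set (HeightOneSpectrum (𝓞 K))} (hSfin : S.Finite)
    (hS : ∀ v : HeightOneSpectrum (𝓞 K), (p : 𝓞 K) ∉ v.asIdeal →
      (Rat.HeightOneSpectrum.primesEquiv (v.under (𝓞 ℚ)) : ℕ) ∣ W.conductorNorm ℤ →
      v.asIdeal.ramificationIdx (𝓞 ℚ) = 1 → v.asIdeal.inertiaDeg (𝓞 ℚ) = 1 → v ∈ S) (n : ℕ) :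
    XAc.HasCharValuationAt (W.baseChange K) p κ 𝔭 S γ n ↔
      ∃ _ : Finite (selmerAcBase (W.baseChange K) p 𝔭 S),
        Nat.card (selmerAcBase (W.baseChange K) p 𝔭 S) =
          p ^ n * Nat.card (IwasawaDual.EndCoinvariants
            (conjSelmerAc (W.baseChange K) p κ 𝔭 S γ - 1)) := by
  haveI := XAc.module_finite κ 𝔭 S γ hSfin (W := W.baseChange K)
  exact XAc.hasCharValuationAt_iff_card_base (W.baseChange K) p κ 𝔭 S γ
    (h.controlMap_bijective_of_conductor_split_subset K hK hκ hγ.out 𝔭 h𝔭 he hf S hS) n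

end RouteR1

end Summit.BirchSwinnertonDyer.Rank1Residual.X11b

end
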